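import Summits.Langlands.Langlands.Theorems.PhantomRMYoshidaResiduallyYoshidaLiftingInnerTwistDihedral
import Summits.Langlands.Langlands.Theorems.PhantomRMYoshidaResiduallyYoshidaLiftingBlockTriangularCharpolyReduction
import Mathlib.LinearAlgebra.Matrix.Charpoly.Basic
import Mathlib.Algebra.Polynomial.Eval.Coeff
import HarnessLib

/-!
# Route `PhantomRMYoshida`, crux `ResiduallyYoshidaLifting` (stmt-Langlands-13639), line `sector-klingen-split`:
# stubs W2 `stub_innerTwistResidualShadow` and W3 `stub_innerTwistOffGeneric` — the residual shadow of an inner twist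

Registered sub-goals of the checked skeleton `Lines/sector_klingen_split.lean` (rev 15, lead c5-0).

* **W2 `stub_innerTwistResidualShadow`.**  Let `rint : Γ → GL₄(ℤ̄_p)` (`ℤ̄_p = 𝒪[ℚ̄_p]`) reduce through
  `red : ℤ̄_p → k` to `h (σ̄, B; 0, σ̄') h⁻¹`, and let `rint ⊗ ℚ̄_p` admit an INNER TWIST by an integral-unit valued
  character `χ`: `A · rint(g) · A⁻¹ = χ(g) · rint(g)` for one `A ∈ GL₄(ℚ̄_p)`.  Then `σ̄ ⊕ σ̄'` and `(σ̄ ⊕ σ̄') ⊗ χ̄`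
  (`χ̄ = red ∘ χ`) have the same characteristic polynomials.
  Proof: conjugate matrices have equal characteristic polynomials (`Matrix.charpoly_units_conj`), so
  `charpoly (rint g) = charpoly (χ(g) rint g)` in `ℚ̄_p[X]`; both sides are images of integral polynomials
  (`Matrix.charpoly_map`) and `ℤ̄_p[X] → ℚ̄_p[X]` is injective (`Polynomial.map_injective`), so the identity holds in
  `ℤ̄_p[X]`; reduce it through `red` (`Matrix.charpoly_map` again); the reduction of `rint g` is conjugate to the block
  upper-triangular `(σ̄ g, B g; 0, σ̄' g)` and that of `χ(g) rint g` to `(χ̄(g) σ̄ g, χ̄(g) B g; 0, χ̄(g) σ̄' g)`, and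
  block-triangular characteristic polynomials multiply (`Matrix.charpoly_fromBlocks_zero₂₁`, `Matrix.charpoly_reindex`).
* **W3 `stub_innerTwistOffGeneric`** (assembly of W2 and the landed W `stub_innerTwistDihedral`, p170739): if moreover
  `σ̄, σ̄'` are irreducible, then `σ̄ ≅ σ̄ ⊗ χ̄` (a dihedral constituent) or `σ̄' ⊗ χ̄ ≅ σ̄` (a twist pair) up to
  `GL₂(k)`-conjugation — W applied to the character `χ̄ := red ∘ χ : Γ → kˣ` and the identity of W2.

No new definitions; helper lemmas are private.
-/

noncomputable section

-- `Summit.Langlands.Langlands.…` (summit = sub-problem name, D-0017 layout) trips `dupNamespace` on every decl;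
-- project-wide option (lakefile `weak.linter.dupNamespace = false`).
set_option linter.dupNamespace false
set_option autoImplicit false

open scoped Matrix

namespace Summit.Langlands.Langlands.Cruxes.ResiduallyYoshidaLifting.SectorKlingenSplit.Fibre

open Literature.NumberTheory.GaloisRepresentations

/-! ### Linear algebra: inner twists and characteristic polynomials -/

/-- An integral matrix `M` over a subring `O` of a field `F` which is conjugate over `F` to its scalar multiple
`c • M` (`c ∈ O`) has the same characteristic polynomial as `c • M` in `O[X]`: conjugate matrices have equal
characteristic polynomials, `charpoly` commutes with the (injective) inclusion `O[X] → F[X]`. [folklore] -/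
private theorem charpoly_eq_charpoly_smul_of_conj {F : Type*} [Field F] {O : Subring F} {n : Type*} [Fintype n]
    [DecidableEq n] (M : Matrix n n O) (A : GL n F) (c : O)
    (h : A.val * M.map O.subtype * (A⁻¹).val = (c : F) • M.map O.subtype) :
    M.charpoly = (c • M).charpoly := by
  apply Polynomial.map_injective O.subtype O.subtype_injective
  rw [← Matrix.charpoly_map, ← Matrix.charpoly_map, Matrix.map_smul' _ _ _ (map_mul O.subtype),
    Subring.subtype_apply, ← h, Matrix.coe_units_inv, Matrix.charpoly_units_conj]

/-- If `charpoly M = charpoly (c • M)` for an integral `4 × 4` matrix `M` over `O` whose reduction through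
`red : O → k` is conjugate to the block upper-triangular `(s, B; 0, s')`, then
`charpoly s · charpoly s' = charpoly (red c • s) · charpoly (red c • s')`: reduce the identity through `red`
(`Matrix.charpoly_map`), the reduction of `c • M` is conjugate to `(red c • s, red c • B; 0, red c • s')`, and
block-triangular characteristic polynomials multiply. [folklore] -/
private theorem charpoly_blocks_eq_of_charpoly_smul_eq {O k : Type*} [CommRing O] [Field k] (red : O →+* k)
    (M : Matrix (Fin 4) (Fin 4) O) (c : O) (hM : M.charpoly = (c • M).charpoly)
    (s s' B : Matrix (Fin 2) (Fin 2) k) (h : GL (Fin 4) k)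
    (hred : M.map red =
      h.val * Matrix.reindex finSumFinEquiv finSumFinEquiv (Matrix.fromBlocks s B 0 s') * (h⁻¹).val) :
    s.charpoly * s'.charpoly = ((red c) • s).charpoly * ((red c) • s').charpoly := by
  -- the reduction of `M` is conjugate to `(s, B; 0, s')`
  have h1 : (M.map red).charpoly = s.charpoly * s'.charpoly := by
    rw [hred, Matrix.coe_units_inv, Matrix.charpoly_units_conj, Matrix.charpoly_reindex,
      Matrix.charpoly_fromBlocks_zero₂₁]
  -- the reduction of `c • M` is conjugate to `(red c • s, red c • B; 0, red c • s')`
  have hsm : (c • M).map red = h.val * Matrix.reindex finSumFinEquiv finSumFinEquiv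
      ((red c) • Matrix.fromBlocks s B 0 s') * (h⁻¹).val := by
    rw [Matrix.map_smul' _ _ _ (map_mul red), hred, ← Matrix.smul_mul, ← Matrix.mul_smul]
    -- `r • (N.submatrix e e) = (r • N).submatrix e e` definitionally (`Matrix.submatrix_smul`)
    rfl
  have h2 : ((c • M).map red).charpoly = ((red c) • s).charpoly * ((red c) • s').charpoly := by
    rw [hsm, Matrix.fromBlocks_smul, smul_zero, Matrix.coe_units_inv, Matrix.charpoly_units_conj,
      Matrix.charpoly_reindex, Matrix.charpoly_fromBlocks_zero₂₁]
  rw [← h1, ← h2, Matrix.charpoly_map, Matrix.charpoly_map, hM]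

/-! ### The registered stubs -/

/-- **Stub W2 `stub_innerTwistResidualShadow`.**  Let `rint : Γ → GL₄(ℤ̄_p)` reduce through `red` to
`h (σ̄, B; 0, σ̄') h⁻¹`, and let the representation `rint ⊗ ℚ̄_p` admit an INNER TWIST by an integral-unit valued
character `χ`: `A · rint(g) · A⁻¹ = χ(g) · rint(g)` for one `A ∈ GL₄(ℚ̄_p)`.  Then `σ̄ ⊕ σ̄'` and `(σ̄ ⊕ σ̄') ⊗ χ̄`
(`χ̄ = red ∘ χ`) have the same characteristic polynomials (conjugate matrices have equal charpolys;
`ℤ̄_p[X] → ℚ̄_p[X]` is injective; reduce; block-triangular charpolys multiply) — the hypothesis of W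
`stub_innerTwistDihedral`. [folklore] -/
theorem stub_innerTwistResidualShadow :
    ∀ (p : ℕ) [Fact p.Prime] (k : Type) [Field k] (Γ : Type) [Group Γ]
      (red : Valued.integer (PadicAlgCl p) →+* k) (σ σ' : Γ →* GL (Fin 2) k) (B : Γ → Matrix (Fin 2) (Fin 2) k)
      (rint : Γ →* GL (Fin 4) (Valued.integer (PadicAlgCl p))) (h : GL (Fin 4) k)
      (A : GL (Fin 4) (PadicAlgCl p)) (χ : Γ →* (Valued.integer (PadicAlgCl p))ˣ),
      (∀ g, (Matrix.GeneralLinearGroup.map red (rint g)).val =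
          h.val * Matrix.reindex finSumFinEquiv finSumFinEquiv
            (Matrix.fromBlocks (σ g).val (B g) 0 (σ' g).val) * (h⁻¹).val) →
      (∀ g, A.val * (Matrix.GeneralLinearGroup.map (Valued.integer (PadicAlgCl p)).subtype (rint g)).val * (A⁻¹).val =
          (((χ g : (Valued.integer (PadicAlgCl p))ˣ) : Valued.integer (PadicAlgCl p)) : PadicAlgCl p) •
            (Matrix.GeneralLinearGroup.map (Valued.integer (PadicAlgCl p)).subtype (rint g)).val) →
      ∀ g, (σ g).val.charpoly * (σ' g).val.charpoly =
        ((red ((χ g : (Valued.integer (PadicAlgCl p))ˣ) : Valued.integer (PadicAlgCl p))) • (σ g).val).charpoly *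
          ((red ((χ g : (Valued.integer (PadicAlgCl p))ˣ) : Valued.integer (PadicAlgCl p))) • (σ' g).val).charpoly := by
  intro p _ k _ Γ _ red σ σ' B rint h A χ hred htw g
  -- `(GL.map f x).val = x.val.map f` definitionally, for `f = subtype` and `f = red`
  have hM : (rint g).val.charpoly =
      ((((χ g : (Valued.integer (PadicAlgCl p))ˣ) : Valued.integer (PadicAlgCl p))) • (rint g).val).charpoly :=
    charpoly_eq_charpoly_smul_of_conj (rint g).val A _ (htw g)
  exact charpoly_blocks_eq_of_charpoly_smul_eq red (rint g).val _ hM (σ g).val (σ' g).val (B g) h (hred g)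

/-- **Stub W3 `stub_innerTwistOffGeneric`** (assembly of W2 and W `stub_innerTwistDihedral`, p170739): an inner twist
`A rint A⁻¹ = χ · rint` (`χ` integral-unit valued) of a representation whose integral frame realises `(σ̄, B; 0, σ̄')`
with IRREDUCIBLE constituents forces `σ̄ ≅ σ̄ ⊗ χ̄` (a dihedral constituent) or `σ̄' ⊗ χ̄ ≅ σ̄` up to
`GL₂(k)`-conjugation (a twist pair): inner-twisted — in particular induced — points of the fibre live off the generic
non-dihedral locus.  Why: W2 gives the charpoly identity `charpoly (σ̄ ⊕ σ̄') = charpoly ((σ̄ ⊕ σ̄') ⊗ χ̄)` for the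
residual character `χ̄ = red ∘ χ : Γ → kˣ`, and W (Brauer–Nesbitt + Schur) converts it into one of the two
conjugations. [folklore] -/
theorem stub_innerTwistOffGeneric :
    ∀ (p : ℕ) [Fact p.Prime] (k : Type) [Field k] (Γ : Type) [Group Γ]
      (red : Valued.integer (PadicAlgCl p) →+* k) (σ σ' : Γ →* GL (Fin 2) k) (B : Γ → Matrix (Fin 2) (Fin 2) k)
      (rint : Γ →* GL (Fin 4) (Valued.integer (PadicAlgCl p))) (h : GL (Fin 4) k)
      (A : GL (Fin 4) (PadicAlgCl p)) (χ : Γ →* (Valued.integer (PadicAlgCl p))ˣ),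
      Representation.IsIrreducible ((glStdRepresentation (Fin 2) k).comp σ) →
      Representation.IsIrreducible ((glStdRepresentation (Fin 2) k).comp σ') →
      (∀ g, (Matrix.GeneralLinearGroup.map red (rint g)).val =
          h.val * Matrix.reindex finSumFinEquiv finSumFinEquiv
            (Matrix.fromBlocks (σ g).val (B g) 0 (σ' g).val) * (h⁻¹).val) →
      (∀ g, A.val * (Matrix.GeneralLinearGroup.map (Valued.integer (PadicAlgCl p)).subtype (rint g)).val * (A⁻¹).val =
          (((χ g : (Valued.integer (PadicAlgCl p))ˣ) : Valued.integer (PadicAlgCl p)) : PadicAlgCl p) •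
            (Matrix.GeneralLinearGroup.map (Valued.integer (PadicAlgCl p)).subtype (rint g)).val) →
      (∃ T : GL (Fin 2) k, ∀ g, (T * σ g * T⁻¹).val =
          (red ((χ g : (Valued.integer (PadicAlgCl p))ˣ) : Valued.integer (PadicAlgCl p))) • (σ g).val) ∨
      (∃ T : GL (Fin 2) k, ∀ g, (T * σ g * T⁻¹).val =
          (red ((χ g : (Valued.integer (PadicAlgCl p))ˣ) : Valued.integer (PadicAlgCl p))) • (σ' g).val) := by
  intro p _ k _ Γ _ red σ σ' B rint h A χ hσ hσ' hred htw
  -- the residual character `χ̄ = red ∘ χ : Γ → kˣ`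
  set χbar : Γ →* kˣ := (Units.map (red : Valued.integer (PadicAlgCl p) →+* k).toMonoidHom).comp χ with hχbar
  have hχ : ∀ g, ((χbar g : kˣ) : k) =
      red ((χ g : (Valued.integer (PadicAlgCl p))ˣ) : Valued.integer (PadicAlgCl p)) := fun g ↦ by
    simp [hχbar, Units.coe_map]
  -- W2: the charpoly identity for `χ̄`
  have hcp : ∀ g, (σ g).val.charpoly * (σ' g).val.charpoly =
      (((χbar g : kˣ) : k) • (σ g).val).charpoly * (((χbar g : kˣ) : k) • (σ' g).val).charpoly := fun g ↦ by
    rw [hχ g]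
    exact stub_innerTwistResidualShadow p k Γ red σ σ' B rint h A χ hred htw g
  -- W: a dihedral constituent or a twist pair
  rcases stub_innerTwistDihedral k Γ σ σ' χbar hσ hσ' hcp with ⟨T, hT⟩ | ⟨T, hT⟩
  · exact Or.inl ⟨T, fun g ↦ by rw [hT g, hχ g]⟩
  · exact Or.inr ⟨T, fun g ↦ by rw [hT g, hχ g]⟩

end Summit.Langlands.Langlands.Cruxes.ResiduallyYoshidaLifting.SectorKlingenSplit.Fibre

end
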